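import Summits.Ventures.CertifiedManyBodySolver.Theses.TcThermcert1
import Literature.MathematicalPhysics.QuantumLattice.HubbardNNNHoppingFluxThermal
import HarnessLib

/-!
# Line `zerofree_corridor` on K1 = `TcThermcert1.ThermalStiffnessCeilingU8b10_le_1o8` (stmt-Ventures-26381) — CHECKED SKELETON

Idea `Ideas/zero-free-corridor.md` (idea-1 of CENSUS-TcThermcert1-R159, trigger (β)); planner hubbard-floor-idea-rescuer g6 (BN-resc-6).
Route decl concluded BY NAME: `ThermalStiffnessCeilingU8b10_le_1o8_of : stub₁ → stub₂ → stub₃ → TcThermcert1.ThermalStiffnessCeilingU8b10_le_1o8`.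

THE LINE. `g_L(β,θ) := log Z_L(β,0) − log Z_L(β,θ)` (canonical `(N_L,S^z=0)` sector of the seam-flux `t–t′` torus, `δ = 1/8`) is the flux
cost whose quadratic lower bound `10 ρ_s θ² ≤ g_L(10,θ)` is K1's premise. Two facts and one bet:
* FLUX-BLINDNESS (§A–§C, PROVED here, 0 sorry): `tr_p H_L(θ)^k = tr_p H_L(0)^k` for every `k < L` (every sector `p`, every `t′, U`,
  every `L ≥ 3`): a closed walk of fewer than `L` hops cannot wind the torus. Hence (§D–§E, PROVED) `β ↦ Z_L(β,θ) − Z_L(β,0)` vanishes to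
  order `L` at `β = 0`.
* CORRIDOR TRANSFER (`stub_corridorTransfer`, pure complex analysis, all ingredients in Mathlib/tree): two functions analytic, zero-free and
  of size `e^{±M}` on a corridor around `[0,b]` which agree to order `L` at `0` have `|log f(b) − log g(b)| ≤ C (M+1) r^L`, `r < 1`.
* A-PRIORI DATA (`stub_corridorData`, M-sized): `Z_L(·,θ)` is entire, `|Z_L| ≤ 4^{L²} e^{|β|‖H_L‖}`, `Z_L(x) ≥ e^{−x‖H_L‖}`, `‖H_L‖ = O(L²)`.
* HYPOTHESIS Z (`stub_zeroFreeStrip`, THE BET): an `L`-uniform zero-free corridor of `β ↦ Z_L(β,θ)` around `[0,10]` for `|θ| ≤ θ₁` at the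
  anchor `(t′,U,n) = (0,8,7/8)` — no Fisher zero of the twisted canonical family reaches the temperature segment `T ≥ t/10`.
Then `|g_L(10,θ)| ≤ C (A L² + 1) r^L → 0` uniformly in `|θ| ≤ θ₁`, which contradicts `10 ρ_s θ² ≤ g_L` at `θ = min θ₀ θ₁` for any
`ρ_s > 0` (§F, PROVED; honours `Disproof.k1_false_without_theta0_pos` / `_fluxPremise`: the flux premise is consumed at a positive twist).

§A  (A1) the trace of a power of a trinomial pencil `M₀ + u M₊ + u⁻¹ M₋` on the unit circle is a trigonometric polynomial of degree `≤ k`;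
    (A2) a trigonometric polynomial of degree `k < L` that is `2π/L`-periodic is constant (root-of-unity averaging).
§B  the uniformly twisted `t–t'` torus IS such a pencil in `u = e^{iθ/L}` (`uniformTwistTT'_eq_pencil`); the seam-flux torus is
    `2π`-periodic in `θ` and gauge-equivalent to it on every coordinate sector (tree `conj_hubbardTorusTT'Flux_eq_uniform`, `L ≥ 3`).
§C  flux-blindness of the first `L - 1` sector moments.   §D  `(d/dβ)^k tr e^{−βH}|₀ = (−1)^k tr H^k`.   §E  the K1 objects.
§F  sockets: twist-insensitivity ⇒ the leaf (proved); corridor, corridor data, Hypothesis Z.   §G  the three stubs and the composition.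
-/

noncomputable section

namespace Summit.Ventures.CertifiedManyBodySolver.Cruxes.ThermalStiffnessCeilingU8b10_le_1o8.ZerofreeCorridor

open Matrix Finset Polynomial
open Literature.MathematicalPhysics.QuantumLattice
open Literature.MathematicalPhysics.QuantumFieldTheory
open scoped ComplexConjugate

/-! ## §A1 Trinomial pencils: `tr (M₀ + u M₊ + u⁻¹ M₋)^k` is a trigonometric polynomial of degree `≤ k` -/

section Pencil

variable {m : Type*} [Fintype m] [DecidableEq m]

/-- The polynomial lift `Q(X) = M₋ + X M₀ + X² M₊` of the pencil (so that `u⁻¹ Q(u) = M₀ + u M₊ + u⁻¹ M₋`). -/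
def pencilPoly (M₀ Mp Mm : Matrix m m ℂ) : Matrix m m ℂ[X] :=
  Mm.map Polynomial.C + (Polynomial.X : ℂ[X]) • M₀.map Polynomial.C + ((Polynomial.X : ℂ[X]) ^ 2) • Mp.map Polynomial.C

omit [Fintype m] [DecidableEq m] in
/-- Every entry of the lift has degree `≤ 2`. [folklore] -/
theorem natDegree_pencilPoly_apply_le (M₀ Mp Mm : Matrix m m ℂ) (i j : m) :
    (pencilPoly M₀ Mp Mm i j).natDegree ≤ 2 := by
  simp only [pencilPoly, Matrix.add_apply, Matrix.smul_apply, Matrix.map_apply, smul_eq_mul]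
  refine (natDegree_add_le _ _).trans (max_le ((natDegree_add_le _ _).trans (max_le ?_ ?_)) ?_)
  · rw [natDegree_C]; omega
  · exact (natDegree_mul_C_le _ _).trans (natDegree_X_le.trans (by omega))
  · exact (natDegree_mul_C_le _ _).trans (natDegree_X_pow_le 2)

/-- Every entry of the `k`-th power of the lift has degree `≤ 2k`. [folklore] -/
theorem natDegree_pencilPoly_pow_apply_le (M₀ Mp Mm : Matrix m m ℂ) (k : ℕ) (i j : m) :
    ((pencilPoly M₀ Mp Mm ^ k) i j).natDegree ≤ 2 * k := by
  induction k generalizing i j with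
  | zero =>
    rw [pow_zero, one_apply]
    split_ifs <;> simp
  | succ k ih =>
    rw [pow_succ, Matrix.mul_apply]
    refine natDegree_sum_le_of_forall_le _ _ fun l _ => ?_
    exact natDegree_mul_le.trans (by have := ih i l; have := natDegree_pencilPoly_apply_le M₀ Mp Mm l j; omega)

/-- The trace of the `k`-th power of the lift has degree `≤ 2k`. [folklore] -/
theorem natDegree_trace_pencilPoly_pow_le (M₀ Mp Mm : Matrix m m ℂ) (k : ℕ) :
    ((pencilPoly M₀ Mp Mm ^ k).trace).natDegree ≤ 2 * k := by
  unfold Matrix.trace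
  exact natDegree_sum_le_of_forall_le _ _ fun i _ => natDegree_pencilPoly_pow_apply_le M₀ Mp Mm k i i

omit [Fintype m] [DecidableEq m] in
/-- Evaluating the lift at `u` gives `M₋ + u M₀ + u² M₊`. [folklore] -/
theorem pencilPoly_map_eval (M₀ Mp Mm : Matrix m m ℂ) (u : ℂ) :
    (pencilPoly M₀ Mp Mm).map (Polynomial.eval u) = Mm + u • M₀ + (u ^ 2) • Mp := by
  ext i j
  simp only [pencilPoly, Matrix.map_apply, Matrix.add_apply, Matrix.smul_apply, smul_eq_mul, Polynomial.eval_add,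
    Polynomial.eval_mul, Polynomial.eval_C, Polynomial.eval_X, Polynomial.eval_pow]

/-- **(A1)** On the unit circle `u = e^{iψ}`: `tr (M₀ + u M₊ + u⁻¹ M₋)^k = Σ_{d ≤ 2k} g_d e^{i(d-k)ψ}` with the
coefficients `g_d` of `tr Q(X)^k` (independent of `ψ`). [folklore] -/
theorem trace_pencil_pow_eq_sum (M₀ Mp Mm : Matrix m m ℂ) (k : ℕ) :
    ∃ g : ℕ → ℂ, ∀ ψ : ℝ,
      ((M₀ + Complex.exp ((ψ : ℂ) * Complex.I) • Mp + Complex.exp (-((ψ : ℂ) * Complex.I)) • Mm) ^ k).trace =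
        ∑ d ∈ Finset.range (2 * k + 1), g d * Complex.exp ((ψ : ℂ) * Complex.I * ((d : ℂ) - k)) := by
  refine ⟨fun d => ((pencilPoly M₀ Mp Mm ^ k).trace).coeff d, fun ψ => ?_⟩
  set u : ℂ := Complex.exp ((ψ : ℂ) * Complex.I) with hu
  set v : ℂ := Complex.exp (-((ψ : ℂ) * Complex.I)) with hv
  have hvu : v * u = 1 := by rw [hu, hv, ← Complex.exp_add, neg_add_cancel, Complex.exp_zero]
  -- `M₀ + u Mp + v Mm = v • Q(u)`
  have hpencil : M₀ + u • Mp + v • Mm = v • (Mm + u • M₀ + (u ^ 2) • Mp) := by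
    rw [smul_add, smul_add, smul_smul, smul_smul, hvu, one_smul, pow_two, ← mul_assoc, hvu, one_mul]
    abel
  have htrace : ((Mm + u • M₀ + (u ^ 2) • Mp) ^ k).trace = ((pencilPoly M₀ Mp Mm ^ k).trace).eval u := by
    rw [← pencilPoly_map_eval, ← Polynomial.coe_evalRingHom, ← Matrix.map_pow, AddMonoidHom.map_trace]
  rw [hpencil, _root_.smul_pow, trace_smul, smul_eq_mul, htrace,
    eval_eq_sum_range' (n := 2 * k + 1) (lt_of_le_of_lt (natDegree_trace_pencilPoly_pow_le M₀ Mp Mm k) (by omega)),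
    Finset.mul_sum]
  refine Finset.sum_congr rfl fun d _ => ?_
  have hexp : v ^ k * u ^ d = Complex.exp ((ψ : ℂ) * Complex.I * ((d : ℂ) - k)) := by
    rw [hu, hv, ← Complex.exp_nat_mul, ← Complex.exp_nat_mul, ← Complex.exp_add]
    congr 1
    ring
  rw [← hexp]
  ring

end Pencil

/-! ## §A2 A trigonometric polynomial of degree `k < L` with period `2π/L` is constant -/

/-- Root-of-unity sums: `Σ_{l<L} e^{2πi l (d-k)/L} = 0` unless `L ∣ (d - k)`; here `|d - k| < L`, `d ≠ k`. [folklore] -/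
theorem sum_exp_two_pi_mul_div_eq_zero {k L D d : ℕ} (hkL : k < L) (hD : D ≤ k + L) (hd : d < D) (hdk : d ≠ k) :
    ∑ l ∈ Finset.range L, Complex.exp (((2 * Real.pi * l / L : ℝ) : ℂ) * Complex.I * ((d : ℂ) - k)) = 0 := by
  have hL0 : (L : ℂ) ≠ 0 := by exact_mod_cast (show L ≠ 0 by omega)
  set ω : ℂ := Complex.exp (2 * Real.pi * Complex.I * ((d : ℂ) - k) / L) with hω
  have hterm : ∀ l : ℕ, Complex.exp (((2 * Real.pi * l / L : ℝ) : ℂ) * Complex.I * ((d : ℂ) - k)) = ω ^ l := by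
    intro l
    rw [hω, ← Complex.exp_nat_mul]
    congr 1
    push_cast
    field_simp
  simp_rw [hterm]
  have hω1 : ω ≠ 1 := by
    intro h
    rw [hω, Complex.exp_eq_one_iff] at h
    obtain ⟨n, hn⟩ := h
    have hπ : (2 * (Real.pi : ℂ) * Complex.I) ≠ 0 := by simp [Real.pi_ne_zero, Complex.I_ne_zero]
    have h2 : ((d : ℂ) - k) = n * L := by
      have e1 : ((d : ℂ) - k) = (2 * Real.pi * Complex.I * ((d : ℂ) - k) / L) * L / (2 * Real.pi * Complex.I) := by
        field_simp
      rw [e1, hn]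
      field_simp
    have h3 : ((d : ℤ) - k : ℤ) = n * L := by exact_mod_cast h2
    have hd1 : (d : ℤ) < k + L := by exact_mod_cast (lt_of_lt_of_le hd hD)
    have hd0 : (0 : ℤ) ≤ d := by positivity
    have hk1 : (k : ℤ) < L := by exact_mod_cast hkL
    have hdk' : (d : ℤ) ≠ k := by exact_mod_cast hdk
    rcases lt_trichotomy n 0 with hn0 | hn0 | hn0
    · nlinarith
    · rw [hn0, zero_mul] at h3
      exact hdk' (by omega)
    · nlinarith
  have hωL : ω ^ L = 1 := by
    rw [hω, ← Complex.exp_nat_mul]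
    have : (L : ℂ) * (2 * Real.pi * Complex.I * ((d : ℂ) - k) / L) = (((d : ℤ) - k : ℤ) : ℂ) * (2 * Real.pi * Complex.I) := by
      push_cast
      field_simp
    rw [this, Complex.exp_int_mul_two_pi_mul_I]
  rw [geom_sum_eq hω1, hωL, sub_self, zero_div]

/-- **(A2)** If `f(ψ) = Σ_{d<D} g_d e^{i(d-k)ψ}` with `D ≤ k + L`, `k < L`, and `f(ψ + 2π/L) = f(ψ)`, then `f` is constant:
averaging over the `L` shifts kills every frequency `d - k ≠ 0` (all have `|d - k| < L`). [folklore] -/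
theorem trigPoly_eq_const_of_periodic {k L D : ℕ} (hkL : k < L) (hD : D ≤ k + L) (g : ℕ → ℂ) (f : ℝ → ℂ)
    (hf : ∀ ψ : ℝ, f ψ = ∑ d ∈ Finset.range D, g d * Complex.exp ((ψ : ℂ) * Complex.I * ((d : ℂ) - k)))
    (hper : ∀ ψ : ℝ, f (ψ + 2 * Real.pi / L) = f ψ) : ∀ ψ : ℝ, f ψ = f 0 := by
  have hL0 : (L : ℂ) ≠ 0 := by exact_mod_cast (show L ≠ 0 by omega)
  -- the constant
  set c : ℂ := ∑ d ∈ Finset.range D, if d = k then g d else 0 with hc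
  -- iterated periodicity
  have hshift : ∀ (l : ℕ) (ψ : ℝ), f (ψ + 2 * Real.pi * l / L) = f ψ := by
    intro l
    induction l with
    | zero => intro ψ; simp
    | succ l ih =>
      intro ψ
      have : ψ + 2 * Real.pi * (l + 1 : ℕ) / L = (ψ + 2 * Real.pi * l / L) + 2 * Real.pi / L := by
        push_cast; ring
      rw [this, hper, ih]
  have hmain : ∀ ψ : ℝ, (L : ℂ) * f ψ = (L : ℂ) * c := by
    intro ψ
    have hsum : ∑ l ∈ Finset.range L, f (ψ + 2 * Real.pi * l / L) = (L : ℂ) * f ψ := by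
      rw [Finset.sum_congr rfl fun l _ => hshift l ψ, Finset.sum_const, Finset.card_range, nsmul_eq_mul]
    rw [← hsum]
    simp_rw [hf]
    rw [Finset.sum_comm]
    have hsplit : ∀ (d l : ℕ), g d * Complex.exp (((ψ + 2 * Real.pi * l / L : ℝ) : ℂ) * Complex.I * ((d : ℂ) - k)) =
        g d * Complex.exp ((ψ : ℂ) * Complex.I * ((d : ℂ) - k)) *
          Complex.exp (((2 * Real.pi * l / L : ℝ) : ℂ) * Complex.I * ((d : ℂ) - k)) := by
      intro d l
      rw [show ((ψ + 2 * Real.pi * l / L : ℝ) : ℂ) * Complex.I * ((d : ℂ) - k) =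
          (ψ : ℂ) * Complex.I * ((d : ℂ) - k) + ((2 * Real.pi * l / L : ℝ) : ℂ) * Complex.I * ((d : ℂ) - k) by
            push_cast; ring,
        Complex.exp_add]
      ring
    simp_rw [hsplit, ← Finset.mul_sum]
    rw [hc, Finset.mul_sum]
    refine Finset.sum_congr rfl fun d hd => ?_
    rw [Finset.mem_range] at hd
    by_cases hdk : d = k
    · subst hdk
      rw [if_pos rfl]
      have h1 : ∀ l : ℕ, Complex.exp (((2 * Real.pi * l / L : ℝ) : ℂ) * Complex.I * ((d : ℂ) - d)) = 1 := fun l => by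
        rw [sub_self, mul_zero, Complex.exp_zero]
      simp_rw [h1, sub_self, mul_zero, Complex.exp_zero, Finset.sum_const, Finset.card_range, nsmul_eq_mul]
      ring
    · rw [if_neg hdk, sum_exp_two_pi_mul_div_eq_zero hkL hD hd hdk]
      ring
  intro ψ
  have h1 := hmain ψ
  have h2 := hmain 0
  have : f ψ = c := mul_left_cancel₀ hL0 h1
  rw [this, ← mul_left_cancel₀ hL0 h2]

/-! ## §B The uniformly twisted torus is a pencil in `e^{iθ/L}`; the seam-flux torus is `2π`-periodic and gauge-equivalent -/

section Torus

variable {L : ℕ} [NeZero L]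

variable (L) in
/-- Pencil constant part: the `e₂`-hopping (both orientations), and the on-site repulsion. -/
def pencilM₀ (U : ℝ) : Matrix (Finset (Orb (FermionTorus 2 L))) (Finset (Orb (FermionTorus 2 L))) ℂ :=
  -(∑ x : Site 2 L, ∑ σ : Fin 2,
      (creation (orb (FermionTorus.ofTorusSite (Site.shift x 1)) σ) * annihilation (orb (FermionTorus.ofTorusSite x) σ) +
        creation (orb (FermionTorus.ofTorusSite x) σ) * annihilation (orb (FermionTorus.ofTorusSite (Site.shift x 1)) σ))) +
    (U : ℂ) • ∑ y : FermionTorus 2 L, numberOp y 0 * numberOp y 1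

variable (L) in
/-- Pencil `e^{+iθ/L}` part: minus every hop advancing `x₁` by one (`e₁`-bonds and, with weight `t'`, both diagonal families). -/
def pencilMp (t' : ℝ) : Matrix (Finset (Orb (FermionTorus 2 L))) (Finset (Orb (FermionTorus 2 L))) ℂ :=
  -(∑ x : Site 2 L, ∑ σ : Fin 2,
      creation (orb (FermionTorus.ofTorusSite (Site.shift x 0)) σ) * annihilation (orb (FermionTorus.ofTorusSite x) σ)) +
    -(t' : ℂ) • ∑ s : Fin 2, ∑ x : Site 2 L, ∑ σ : Fin 2,
      creation (orb (FermionTorus.ofTorusSite (x + torusDiagJump L s)) σ) * annihilation (orb (FermionTorus.ofTorusSite x) σ)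

variable (L) in
/-- Pencil `e^{-iθ/L}` part: minus every hop retreating `x₁` by one. -/
def pencilMm (t' : ℝ) : Matrix (Finset (Orb (FermionTorus 2 L))) (Finset (Orb (FermionTorus 2 L))) ℂ :=
  -(∑ x : Site 2 L, ∑ σ : Fin 2,
      creation (orb (FermionTorus.ofTorusSite x) σ) * annihilation (orb (FermionTorus.ofTorusSite (Site.shift x 0)) σ)) +
    -(t' : ℂ) • ∑ s : Fin 2, ∑ x : Site 2 L, ∑ σ : Fin 2,
      creation (orb (FermionTorus.ofTorusSite x) σ) * annihilation (orb (FermionTorus.ofTorusSite (x + torusDiagJump L s)) σ)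

/-- **The uniformly twisted `t–t'` torus is a trinomial pencil in `e = e^{iθ/L}`**:
`uniformTwistTT' θ = M₀ + e • M₊ + conj e • M₋`. [cite: Watanabe2019, §2.2.3 and §4.1] -/
theorem uniformTwistTT'_eq_pencil (t' U θ : ℝ) :
    uniformTwistTT' L t' U θ =
      pencilM₀ L U + ((Circle.exp (θ / L) : Circle) : ℂ) • pencilMp L t' +
        conj ((Circle.exp (θ / L) : Circle) : ℂ) • pencilMm L t' := by
  set e : ℂ := ((Circle.exp (θ / L) : Circle) : ℂ) with he
  have h0 : ∀ x : Site 2 L, ((uniformTwistConfig L θ (x, 0) : Circle) : ℂ) = e := fun x => by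
    rw [uniformTwistConfig_apply, if_pos rfl]
  have h1 : ∀ x : Site 2 L, ((uniformTwistConfig L θ (x, 1) : Circle) : ℂ) = 1 := fun x => by
    rw [uniformTwistConfig_apply, if_neg (by decide), Circle.coe_one]
  -- the nearest-neighbour hopping in the uniform twist, split by direction and orientation
  have hhop : (∑ x : Site 2 L, ∑ i : Fin 2, ∑ σ : Fin 2,
      ((((uniformTwistConfig L θ) (x, i) : Circle) : ℂ) •
          (creation (orb (FermionTorus.ofTorusSite (Site.shift x i)) σ) *
            annihilation (orb (FermionTorus.ofTorusSite x) σ)) +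
        (starRingEnd ℂ) (((uniformTwistConfig L θ) (x, i) : Circle) : ℂ) •
          (creation (orb (FermionTorus.ofTorusSite x) σ) *
            annihilation (orb (FermionTorus.ofTorusSite (Site.shift x i)) σ)))) =
      e • (∑ x : Site 2 L, ∑ σ : Fin 2,
          creation (orb (FermionTorus.ofTorusSite (Site.shift x 0)) σ) * annihilation (orb (FermionTorus.ofTorusSite x) σ)) +
      conj e • (∑ x : Site 2 L, ∑ σ : Fin 2,
          creation (orb (FermionTorus.ofTorusSite x) σ) * annihilation (orb (FermionTorus.ofTorusSite (Site.shift x 0)) σ)) +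
      ((∑ x : Site 2 L, ∑ σ : Fin 2,
          creation (orb (FermionTorus.ofTorusSite (Site.shift x 1)) σ) * annihilation (orb (FermionTorus.ofTorusSite x) σ)) +
        ∑ x : Site 2 L, ∑ σ : Fin 2,
          creation (orb (FermionTorus.ofTorusSite x) σ) * annihilation (orb (FermionTorus.ofTorusSite (Site.shift x 1)) σ)) := by
    rw [Finset.sum_comm, Fin.sum_univ_two]
    simp only [h0, h1, map_one, one_smul, Finset.sum_add_distrib, ← Finset.smul_sum]
  -- the diagonal hopping with the constant Peierls amplitude `e`
  have hdiag : diagPeierlsHopping L (fun _ _ => e) =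
      e • (∑ s : Fin 2, ∑ x : Site 2 L, ∑ σ : Fin 2,
          creation (orb (FermionTorus.ofTorusSite (x + torusDiagJump L s)) σ) *
            annihilation (orb (FermionTorus.ofTorusSite x) σ)) +
        conj e • (∑ s : Fin 2, ∑ x : Site 2 L, ∑ σ : Fin 2,
          creation (orb (FermionTorus.ofTorusSite x) σ) *
            annihilation (orb (FermionTorus.ofTorusSite (x + torusDiagJump L s)) σ)) := by
    unfold diagPeierlsHopping
    simp only [Finset.sum_add_distrib, ← Finset.smul_sum]
  unfold uniformTwistTT'
  rw [magneticHubbardTorus_eq, hhop, hdiag]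
  unfold pencilM₀ pencilMp pencilMm
  simp only [Finset.sum_add_distrib]
  module

/-- `conj e^{iψ} = e^{-iψ}` on the unit circle, in the form used by the pencil lemma. [folklore] -/
theorem conj_coe_circleExp (ψ : ℝ) :
    conj ((Circle.exp ψ : Circle) : ℂ) = Complex.exp (-((ψ : ℂ) * Complex.I)) := by
  rw [← Circle.coe_inv_eq_conj, ← Circle.exp_neg, Circle.coe_exp]
  push_cast
  ring_nf

/-- The diagonal seam twist is `2π`-periodic in the flux. [folklore] -/
theorem diagSeamTwist_add_two_pi (θ : ℝ) : diagSeamTwist L (θ + 2 * Real.pi) = diagSeamTwist L θ := by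
  have h : Circle.exp (θ + 2 * Real.pi) = Circle.exp θ := by
    rw [Circle.exp_add, Circle.exp_two_pi, mul_one]
  unfold diagSeamTwist
  rw [h]

/-- **The seam-flux `t–t'` torus is `2π`-periodic in the flux** (only `e^{±iθ}` enters). [cite: ByersYang1961] -/
theorem hubbardTorusTT'Flux_add_two_pi (t' U θ : ℝ) :
    hubbardTorusTT'Flux L t' U (θ + 2 * Real.pi) = hubbardTorusTT'Flux L t' U θ := by
  rw [hubbardTorusTT'Flux_eq, hubbardTorusTT'Flux_eq, seamTwist_periodic, diagSeamTwist_add_two_pi]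

end Torus

/-! ### Traces of powers of sector blocks are gauge invariant -/

section Blocks

variable {n : Type*} [Fintype n]

/-- `(P M Q)^k = P M^k Q` when `Q P = 1` and `P Q = 1`. [folklore] -/
theorem conj_pow_eq {q : Type*} [Fintype q] [DecidableEq q] [DecidableEq n] (P : Matrix q n ℂ) (Q : Matrix n q ℂ)
    (M : Matrix n n ℂ) (hQP : Q * P = 1) (hPQ : P * Q = 1) (k : ℕ) : (P * M * Q) ^ k = P * M ^ k * Q := by
  induction k with
  | zero => rw [pow_zero, pow_zero, Matrix.mul_one, hPQ]
  | succ k ih =>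
    rw [pow_succ, ih, pow_succ]
    simp only [Matrix.mul_assoc]
    rw [← Matrix.mul_assoc Q P, hQP, Matrix.one_mul]

/-- `tr (P M Q)^k = tr M^k` when `Q P = 1 = P Q`. [folklore] -/
theorem trace_conj_pow_eq {q : Type*} [Fintype q] [DecidableEq q] [DecidableEq n] (P : Matrix q n ℂ) (Q : Matrix n q ℂ)
    (M : Matrix n n ℂ) (hQP : Q * P = 1) (hPQ : P * Q = 1) (k : ℕ) : ((P * M * Q) ^ k).trace = (M ^ k).trace := by
  rw [conj_pow_eq P Q M hQP hPQ, Matrix.trace_mul_cycle, hQP, Matrix.one_mul]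

/-- Unit-modulus diagonal conjugation does not change traces of powers of a sector block (for WHATEVER decidability
instance built the big diagonal). [folklore] -/
theorem trace_pow_toBlock_diagonal_conj {inst : DecidableEq n} (v : n → ℂ) (hv : ∀ a, star (v a) * v a = 1)
    (M : Matrix n n ℂ) (p : n → Prop) [Fintype {a // p a}] [DecidableEq {a // p a}] (k : ℕ) :
    (((@diagonal n ℂ inst _ (fun a => star (v a)) * M * @diagonal n ℂ inst _ v).toBlock p p) ^ k).trace =
      ((M.toBlock p p) ^ k).trace := by
  rw [toBlock_diagonal_mul_mul_diagonal]
  have h1 : (fun a : {a // p a} => v a * star (v a)) = fun _ => 1 := funext fun a => by rw [mul_comm]; exact hv a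
  have h2 : (fun a : {a // p a} => star (v a) * v a) = fun _ => 1 := funext fun a => hv a
  refine trace_conj_pow_eq _ _ _ ?_ ?_ k
  · rw [diagonal_mul_diagonal, h1, diagonal_one]
  · rw [diagonal_mul_diagonal, h2, diagonal_one]

end Blocks

section Gauge

variable {L : ℕ} [NeZero L]

/-- **Gauge invariance of the sector moments** (`L ≥ 3`): `tr ((H(θ))|_p)^k = tr ((H_unif(θ))|_p)^k` on every coordinate
sector `p` (the twist `phaseGauge (twistGauge θ)` is diagonal in the occupation basis). [cite: Watanabe2019, §2.2.3 and §4.1] -/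
theorem trace_pow_toBlock_uniformTwistTT'_eq (hL : 3 ≤ L) (t' U θ : ℝ)
    (p : Finset (Orb (FermionTorus 2 L)) → Prop) [Fintype {a // p a}] [DecidableEq {a // p a}] (k : ℕ) :
    (((uniformTwistTT' L t' U θ).toBlock p p) ^ k).trace = (((hubbardTorusTT'Flux L t' U θ).toBlock p p) ^ k).trace := by
  have hunit : ∀ z : Circle, star (z : ℂ) * (z : ℂ) = 1 := fun z => by
    rw [Complex.star_def, ← Complex.normSq_eq_conj_mul_self, Circle.normSq_coe, Complex.ofReal_one]
  rw [uniformTwistTT', ← conj_hubbardTorusTT'Flux_eq_uniform hL t' U θ, phaseGauge_eq, conjTranspose_diagonal_inst]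
  exact trace_pow_toBlock_diagonal_conj _ (fun a => hunit _) _ p k

/-- Sector blocks respect the pencil structure (`toBlock` is linear). [folklore] -/
theorem toBlock_pencil {m : Type*} (A B C : Matrix m m ℂ) (a b : ℂ) (p : m → Prop) :
    (A + a • B + b • C).toBlock p p = A.toBlock p p + a • B.toBlock p p + b • C.toBlock p p := by
  ext i j
  simp [toBlock_apply]

/-! ## §C Flux-blindness of the first `L - 1` sector moments -/

/-- **Flux-blindness of short walks** (`L ≥ 3`, every `t', U`, every coordinate sector `p`, every `k < L`):
`tr ((H^{tt'}_L(θ))|_p)^k = tr ((H^{tt'}_L(0))|_p)^k`. In the uniform gauge the `k`-th sector moment is a trigonometric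
polynomial of degree `≤ k` in `ψ = θ/L` (§A1); it is `2π`-periodic in `θ`, i.e. `2π/L`-periodic in `ψ` (§B); a trigonometric
polynomial of degree `k < L` with that period is constant (§A2). Physically: a closed walk of fewer than `L` hops cannot wind
around the torus, so it cannot feel the Aharonov–Bohm flux. [cite: ByersYang1961] -/
theorem trace_pow_toBlock_hubbardTorusTT'Flux_eq_zero_flux (hL : 3 ≤ L) (t' U θ : ℝ)
    (p : Finset (Orb (FermionTorus 2 L)) → Prop) [Fintype {a // p a}] [DecidableEq {a // p a}] {k : ℕ} (hk : k < L) :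
    (((hubbardTorusTT'Flux L t' U θ).toBlock p p) ^ k).trace = (((hubbardTorusTT'Flux L t' U 0).toBlock p p) ^ k).trace := by
  have hL0 : (L : ℝ) ≠ 0 := by exact_mod_cast (show L ≠ 0 by omega)
  -- the moment in the uniform gauge as a function of `ψ = θ/L`
  set f : ℝ → ℂ := fun ψ => (((uniformTwistTT' L t' U (L * ψ)).toBlock p p) ^ k).trace with hf
  -- (A1) structure
  obtain ⟨g, hg⟩ := trace_pencil_pow_eq_sum ((pencilM₀ L U).toBlock p p) ((pencilMp L t').toBlock p p)
    ((pencilMm L t').toBlock p p) k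
  have hstruct : ∀ ψ : ℝ, f ψ = ∑ d ∈ Finset.range (2 * k + 1), g d * Complex.exp ((ψ : ℂ) * Complex.I * ((d : ℂ) - k)) := by
    intro ψ
    rw [← hg ψ, hf]
    simp only
    rw [uniformTwistTT'_eq_pencil, toBlock_pencil, mul_div_cancel_left₀ ψ hL0, conj_coe_circleExp, Circle.coe_exp]
  -- (B) periodicity
  have hper : ∀ ψ : ℝ, f (ψ + 2 * Real.pi / L) = f ψ := by
    intro ψ
    simp only [hf]
    rw [show (L : ℝ) * (ψ + 2 * Real.pi / L) = L * ψ + 2 * Real.pi by field_simp,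
      trace_pow_toBlock_uniformTwistTT'_eq hL, trace_pow_toBlock_uniformTwistTT'_eq hL, hubbardTorusTT'Flux_add_two_pi]
  -- (A2) constancy
  have hconst := trigPoly_eq_const_of_periodic hk (by omega) g f hstruct hper
  have h1 : f (θ / L) = (((hubbardTorusTT'Flux L t' U θ).toBlock p p) ^ k).trace := by
    simp only [hf]
    rw [mul_div_cancel₀ θ hL0, trace_pow_toBlock_uniformTwistTT'_eq hL]
  have h2 : f 0 = (((hubbardTorusTT'Flux L t' U 0).toBlock p p) ^ k).trace := by
    simp only [hf]
    rw [mul_zero, trace_pow_toBlock_uniformTwistTT'_eq hL]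
  rw [← h1, ← h2, hconst]

end Gauge

/-! ## §D Flux-blindness is Taylor-flatness of `β ↦ tr e^{-βH}` at `β = 0` -/

section Flatness

open scoped Matrix.Norms.L2Operator

variable {m : Type*} [Fintype m] [DecidableEq m]

/-- The exponential moments `β ↦ tr (A^k e^{βA})`. -/
def expMoment (A : Matrix m m ℂ) (k : ℕ) (β : ℂ) : ℂ :=
  (A ^ k * NormedSpace.exp (β • A)).trace

/-- `d/dβ tr (A^k e^{βA}) = tr (A^{k+1} e^{βA})` (Mathlib `hasDerivAt_exp_smul_const'` in the Banach algebra of matrices). [folklore] -/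
theorem hasDerivAt_expMoment (A : Matrix m m ℂ) (k : ℕ) (β : ℂ) :
    HasDerivAt (expMoment A k) (expMoment A (k + 1) β) β := by
  have h1 : HasDerivAt (fun u : ℂ => NormedSpace.exp (u • A)) (A * NormedSpace.exp (β • A)) β :=
    hasDerivAt_exp_smul_const' A β
  set Lk : Matrix m m ℂ →L[ℂ] ℂ :=
    LinearMap.toContinuousLinearMap ((Matrix.traceLinearMap m ℂ ℂ) ∘ₗ (LinearMap.mulLeft ℂ (A ^ k))) with hLk
  have hL : ∀ X : Matrix m m ℂ, Lk X = (A ^ k * X).trace := fun X => rfl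
  have h2 := Lk.hasFDerivAt.comp_hasDerivAt β h1
  have heq : (⇑Lk ∘ fun u : ℂ => NormedSpace.exp (u • A)) = expMoment A k := funext fun u => by
    simp only [Function.comp_apply, hL, expMoment]
  rw [heq, hL, ← Matrix.mul_assoc, ← pow_succ] at h2
  exact h2

/-- `(d/dβ)^k tr e^{βA} = tr (A^k e^{βA})`. [folklore] -/
theorem iteratedDeriv_expMoment_zero (A : Matrix m m ℂ) (k : ℕ) : iteratedDeriv k (expMoment A 0) = expMoment A k := by
  induction k with
  | zero => rw [iteratedDeriv_zero]
  | succ k ih =>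
    rw [iteratedDeriv_succ, ih]
    funext β
    exact (hasDerivAt_expMoment A k β).deriv

/-- **Taylor coefficients of the partition function at infinite temperature**: `(d/dβ)^k tr e^{-βH} |_{β=0} = (-1)^k tr H^k`. [folklore] -/
theorem iteratedDeriv_trace_exp_neg_smul (H : Matrix m m ℂ) (k : ℕ) :
    iteratedDeriv k (fun β : ℂ => (NormedSpace.exp (-β • H)).trace) 0 = (-1) ^ k * (H ^ k).trace := by
  have heq : (fun β : ℂ => (NormedSpace.exp (-β • H)).trace) = expMoment (-H) 0 := by
    funext β
    simp only [expMoment, pow_zero, Matrix.one_mul, smul_neg, neg_smul]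
  rw [heq, iteratedDeriv_expMoment_zero, expMoment, zero_smul, NormedSpace.exp_zero, Matrix.mul_one,
    show -H = (-1 : ℂ) • H by rw [neg_one_smul], _root_.smul_pow, trace_smul, smul_eq_mul]

end Flatness

/-! ## §E The K1 objects: the canonical sector of `thermalFluxLogZ`, flux-blindness and flatness there -/

section K1

open Summit.Ventures.CertifiedManyBodySolver.Observables

/-- The `(N_L, S^z = 0)` coordinate sector of the `t–t′` torus at doping `δ` (the binder of `thermalFluxLogZ`; reducible, so that
its decidability is inferred). -/
abbrev fluxSector (L : ℕ) (δ : ℝ) (s : Finset (Orb (FermionTorus 2 L))) : Prop :=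
  s.card = 2 * ⌊(1 - δ) * (L : ℝ) ^ 2 / 2⌋₊ ∧
    2 * (s.filter fun i => (ofLex i).2 = 0).card = 2 * ⌊(1 - δ) * (L : ℝ) ^ 2 / 2⌋₊

/-- The `(N_L, S^z=0)` sector block of the seam-flux Hamiltonian `hubbardTorusTT'Flux L tp U θ` at doping `δ`. -/
def fluxBlock (L : ℕ) [NeZero L] (tp U δ θ : ℝ) :
    Matrix {a // fluxSector L δ a} {a // fluxSector L δ a} ℂ :=
  (hubbardTorusTT'Flux L tp U θ).toBlock (fluxSector L δ) (fluxSector L δ)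

/-- The sector partition function at COMPLEX inverse temperature: `Z_L(β, θ) = tr_sector e^{−β H_L(θ)}` (entire in `β`); for real
`β` it is `Matrix.partitionFn β (fluxBlock …)`, whose `Re`-log is `thermalFluxLogZ` (`thermalFluxLogZ_eq_log_re`, `rfl`). -/
def thermalFluxZc (L : ℕ) [NeZero L] (tp U δ θ : ℝ) (β : ℂ) : ℂ :=
  (NormedSpace.exp (-β • fluxBlock L tp U δ θ)).trace

/-- **Flux-blindness of short walks** (support statement of the line): `tr_p H_L(θ)^k = tr_p H_L(0)^k` for every `k < L`. -/
def FluxBlindTracePow (L : ℕ) [NeZero L] (tp U δ θ : ℝ) : Prop :=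
  ∀ k : ℕ, k < L → (fluxBlock L tp U δ θ ^ k).trace = (fluxBlock L tp U δ 0 ^ k).trace

/-- The tree observable is the real log of the sector partition function at real `β` (definitional). -/
theorem thermalFluxLogZ_eq_log_re (L : ℕ) [NeZero L] (tp U δ b θ : ℝ) :
    thermalFluxLogZ L tp U δ b θ = Real.log (thermalFluxZc L tp U δ θ (b : ℂ)).re := by
  rfl

/-- **Flux-blindness holds** at every side `L ≥ 3`, every `t′, U`, doping and flux (§C specialised to the K1 sector). [cite: ByersYang1961] -/
theorem fluxBlindTracePow_of_three_le {L : ℕ} [NeZero L] (hL : 3 ≤ L) (tp U δ θ : ℝ) : FluxBlindTracePow L tp U δ θ :=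
  fun _ hk => trace_pow_toBlock_hubbardTorusTT'Flux_eq_zero_flux hL tp U θ (fluxSector L δ) hk

/-- **Flux-blindness is flatness of order `L` at `β = 0`**: the first `L` Taylor coefficients of `Z_L(·,θ)` and `Z_L(·,0)` agree. [folklore] -/
theorem iteratedDeriv_thermalFluxZc_eq {L : ℕ} [NeZero L] {tp U δ θ : ℝ} (hF : FluxBlindTracePow L tp U δ θ) :
    ∀ k : ℕ, k < L → iteratedDeriv k (thermalFluxZc L tp U δ θ) 0 = iteratedDeriv k (thermalFluxZc L tp U δ 0) 0 := by
  intro k hk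
  have hθ : thermalFluxZc L tp U δ θ = fun β : ℂ => (NormedSpace.exp (-β • fluxBlock L tp U δ θ)).trace := rfl
  have h0 : thermalFluxZc L tp U δ 0 = fun β : ℂ => (NormedSpace.exp (-β • fluxBlock L tp U δ 0)).trace := rfl
  rw [hθ, h0, iteratedDeriv_trace_exp_neg_smul, iteratedDeriv_trace_exp_neg_smul, hF k hk]

/-- Hence, unconditionally for `L ≥ 3`: the Taylor jets of order `L - 1` at `β = 0` of the twisted and untwisted sector partition
functions coincide. [cite: ByersYang1961] -/
theorem iteratedDeriv_thermalFluxZc_eq_of_three_le {L : ℕ} [NeZero L] (hL : 3 ≤ L) (tp U δ θ : ℝ) {k : ℕ} (hk : k < L) :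
    iteratedDeriv k (thermalFluxZc L tp U δ θ) 0 = iteratedDeriv k (thermalFluxZc L tp U δ 0) 0 :=
  iteratedDeriv_thermalFluxZc_eq (fluxBlindTracePow_of_three_le hL tp U δ θ) k hk

end K1

/-! ## §F Sockets: twist-insensitivity ⇒ the leaf; the corridor, corridor data, Hypothesis Z -/

section Sockets

open Filter Topology
open Summit.Ventures.CertifiedManyBodySolver.Observables

/-- Qualitative twist-insensitivity of the `(N_L, S^z=0)` sector free energy at inverse temperature `β`:
for some flux scale `θ₁ > 0`, `|log Z_L(0) − log Z_L(θ)| ≤ ε_L → 0` uniformly in `|θ| ≤ θ₁`. -/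
def TwistInsensitiveAt (tp U n β : ℝ) : Prop :=
  ∃ θ₁ : ℝ, 0 < θ₁ ∧ ∃ ε : ℕ → ℝ, Tendsto ε atTop (𝓝 0) ∧ ∃ L₀ : ℕ,
    ∀ (L : ℕ) [NeZero L], L₀ ≤ L → ∀ θ : ℝ, |θ| ≤ θ₁ →
      |thermalFluxLogZ L tp U (1 - n) β 0 - thermalFluxLogZ L tp U (1 - n) β θ| ≤ ε L

/-- **Socket (PROVED).** Twist-insensitivity at `β > 0` forces the single-temperature thermal stiffness leaf for every `c ≥ 0`
(the flux premise is consumed at the positive twist `θ = min θ₀ θ₁`, as `Disproof.k1_false_without_theta0_pos/_fluxPremise` demand). -/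
theorem leafAtBeta_of_twistInsensitiveAt {tp U n β : ℝ} (hβ : 0 < β) {c : ℚ} (_hc : 0 ≤ c)
    (h : TwistInsensitiveAt tp U n β) : ObsThermalStiffnessSeqCeilingAtBeta tp U n β c := by
  intro ρs θ₀ hρs hθ₀ Ls hLs hst
  obtain ⟨θ₁, hθ₁, ε, hε, L₀, hins⟩ := h
  exfalso
  set θ : ℝ := min θ₀ θ₁ with hθdef
  have hθpos : 0 < θ := lt_min hθ₀ hθ₁
  have hθ0 : |θ| ≤ θ₀ := by rw [abs_of_pos hθpos]; exact min_le_left _ _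
  have hθ1 : |θ| ≤ θ₁ := by rw [abs_of_pos hθpos]; exact min_le_right _ _
  have hev : ∀ᶠ j in atTop, β * ρs * θ ^ 2 ≤ ε (Ls j) := by
    have h1 : ∀ᶠ j in atTop, max 1 L₀ ≤ Ls j := hLs.eventually (eventually_ge_atTop (max 1 L₀))
    filter_upwards [h1] with j hj
    haveI : NeZero (Ls j) := ⟨by omega⟩
    have ha := hst j θ hθ0
    have hb := hins (Ls j) (le_of_max_le_right hj) θ hθ1
    exact ha.trans ((le_abs_self _).trans hb)
  have hlim : Tendsto (fun j => ε (Ls j)) atTop (𝓝 0) := hε.comp hLs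
  have hle : β * ρs * θ ^ 2 ≤ 0 := ge_of_tendsto hlim hev
  have hpos : 0 < β * ρs * θ ^ 2 := by positivity
  linarith

/-- **Hypothesis Z (zero-free β-corridor, uniform in `L` and in small twists).** For all large `L` and all `|θ| ≤ θ₁` the sector
partition function `β ↦ Z_L(β, θ)` has no zero in the open rectangle `(−η, β₁ + η) × (−η, η)·i`. -/
def ZeroFreeStrip (tp U n β₁ η θ₁ : ℝ) : Prop :=
  ∃ L₀ : ℕ, ∀ (L : ℕ) [NeZero L], L₀ ≤ L → ∀ θ : ℝ, |θ| ≤ θ₁ →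
    ∀ β : ℂ, -η < β.re → β.re < β₁ + η → |β.im| < η → thermalFluxZc L tp U (1 - n) θ β ≠ 0

/-- The open corridor `(−η, b + η) × (−η, η)·i` around the real segment `[0, b]`. -/
def corridor (η b : ℝ) : Set ℂ := {z : ℂ | -η < z.re ∧ z.re < b + η ∧ |z.im| < η}

/-- Admissible corridor data with size parameter `M`: `f` is analytic and zero-free on the corridor, `‖f‖ ≤ e^{M}` there, and on
the real segment `f` is real with `f ≥ e^{−M}`. -/
structure CorridorData (η b M : ℝ) (f : ℂ → ℂ) : Prop where
  differentiableOn : DifferentiableOn ℂ f (corridor η b)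
  ne_zero : ∀ z ∈ corridor η b, f z ≠ 0
  norm_le : ∀ z ∈ corridor η b, ‖f z‖ ≤ Real.exp M
  real_on_axis : ∀ x : ℝ, -η < x → x < b + η → (f x).im = 0 ∧ Real.exp (-M) ≤ (f x).re

end Sockets

/-! ## PROBES (FL-RULING 70 (ii) / crit-1 provisos): every cheap closure must FAIL; the file compiles (rc 0) iff each
`fail_if_success` succeeds, i.e. iff NO probe tactic closes its goal. Stubs and the composition are REMOVED from this copy so that
`exact?` cannot pick up `…_of_stubs`. -/

section Probes

open Filter Topology
open Summit.Ventures.CertifiedManyBodySolver.Observables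

/-- The statement of stub 1 (corridor transfer), as a Prop. -/
def StubCorridorTransfer : Prop :=
  ∀ (η b : ℝ), 0 < η → 0 < b →
    ∃ C r : ℝ, 0 < C ∧ 0 ≤ r ∧ r < 1 ∧
      ∀ (L : ℕ) (M : ℝ) (f g : ℂ → ℂ), 0 ≤ M → CorridorData η b M f → CorridorData η b M g →
        (∀ k : ℕ, k < L → iteratedDeriv k f 0 = iteratedDeriv k g 0) →
        |Real.log (f b).re - Real.log (g b).re| ≤ C * (M + 1) * r ^ L

/-- The statement of stub 2 (a-priori corridor data), as a Prop. -/
def StubCorridorData : Prop :=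
  ∀ (tp U n b η θ₁ : ℝ), 0 < η → 0 < b → ZeroFreeStrip tp U n b η θ₁ →
    ∃ A : ℝ, 0 ≤ A ∧ ∃ L₀ : ℕ, ∀ (L : ℕ) [NeZero L], L₀ ≤ L → ∀ θ : ℝ, |θ| ≤ θ₁ →
      CorridorData η b (A * (L : ℝ) ^ 2) (thermalFluxZc L tp U (1 - n) θ)

/-- The statement of stub 3 (Hypothesis Z at the anchor), as a Prop. -/
def StubZ : Prop := ∃ η θ₁ : ℝ, 0 < η ∧ 0 < θ₁ ∧ ZeroFreeStrip 0 8 (7 / 8) 10 η θ₁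

set_option maxHeartbeats 400000
set_option linter.unreachableTactic false
set_option linter.unusedTactic false

/-- P1: `Z → K1` does not close cheaply (else costume). -/
example : StubZ → Summit.Ventures.CertifiedManyBodySolver.Theses.TcThermcert1.ThermalStiffnessCeilingU8b10_le_1o8 := by
  fail_if_success (first | (exact?; done) | (aesop; done) | (simp_all; done) | (tauto; done) | (norm_num; done))
  intro hZ
  fail_if_success (first | (exact?; done) | (aesop; done) | (simp_all; done) | (tauto; done) | (norm_num; done))
  unfold StubZ ZeroFreeStrip at hZ
  unfold Summit.Ventures.CertifiedManyBodySolver.Theses.TcThermcert1.ThermalStiffnessCeilingU8b10_le_1o8 Summit.Ventures.CertifiedManyBodySolver.Observables.ObsThermalStiffnessSeqCeilingAtBeta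
  fail_if_success (first | (aesop; done) | (simp_all; done) | (tauto; done))
  sorry

/-- P2: `Z → stub 2` does not close cheaply (`exact?` on this goal: deterministic whnf timeout at 400k heartbeats — no closure; omitted here). -/
example : StubZ → StubCorridorData := by
  fail_if_success (first | (aesop; done) | (simp_all; done) | (tauto; done) | (norm_num; done))
  unfold StubZ StubCorridorData
  fail_if_success (first | (aesop; done) | (simp_all; done) | (tauto; done))
  sorry

/-- P3: `Z → stub 1` does not close cheaply. -/
example : StubZ → StubCorridorTransfer := by
  fail_if_success (first | (exact?; done) | (aesop; done) | (simp_all; done) | (tauto; done) | (norm_num; done))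
  unfold StubZ StubCorridorTransfer
  fail_if_success (first | (aesop; done) | (simp_all; done) | (tauto; done))
  sorry

/-- P3′: stub 1 alone is not closed by `exact?` / `aesop` / `simp_all` / `tauto` (crit-1 (i): not a one-line Mathlib fact), folded or unfolded. -/
example : StubCorridorTransfer := by
  fail_if_success (first | (exact?; done) | (aesop; done) | (simp_all; done) | (tauto; done) | (norm_num; done))
  unfold StubCorridorTransfer
  intro η b hη hb
  fail_if_success (first | (exact?; done) | (aesop; done) | (simp_all; done) | (tauto; done) | (norm_num; done))
  sorry

/-- P4: no single stub gives K1 cheaply. -/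
example : StubCorridorTransfer → Summit.Ventures.CertifiedManyBodySolver.Theses.TcThermcert1.ThermalStiffnessCeilingU8b10_le_1o8 := by
  fail_if_success (first | (exact?; done) | (aesop; done) | (simp_all; done) | (tauto; done) | (norm_num; done))
  sorry

example : StubCorridorData → Summit.Ventures.CertifiedManyBodySolver.Theses.TcThermcert1.ThermalStiffnessCeilingU8b10_le_1o8 := by
  fail_if_success (first | (exact?; done) | (aesop; done) | (simp_all; done) | (tauto; done) | (norm_num; done))
  sorry

/-- P4′: stubs 1 + 2 together (without Z) do not give K1 cheaply. -/
example : StubCorridorTransfer → StubCorridorData → Summit.Ventures.CertifiedManyBodySolver.Theses.TcThermcert1.ThermalStiffnessCeilingU8b10_le_1o8 := by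
  fail_if_success (first | (exact?; done) | (aesop; done) | (simp_all; done) | (tauto; done) | (norm_num; done))
  sorry

/-- P5: K1 does not give Z cheaply (informational: Z is strictly on the far side). -/
example : Summit.Ventures.CertifiedManyBodySolver.Theses.TcThermcert1.ThermalStiffnessCeilingU8b10_le_1o8 → StubZ := by
  fail_if_success (first | (exact?; done) | (aesop; done) | (simp_all; done) | (tauto; done) | (norm_num; done))
  sorry

/-- P6: Z is not cheaply refutable and not cheaply provable. -/
example : StubZ := by
  fail_if_success (first | (exact?; done) | (aesop; done) | (simp_all; done) | (tauto; done) | (norm_num; done))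
  sorry

example : ¬ StubZ := by
  fail_if_success (first | (exact?; done) | (aesop; done) | (simp_all; done) | (tauto; done) | (norm_num; done))
  sorry

/-- V1 (non-vacuity of stub 1's hypotheses): the constant `1` is admissible corridor data with `M = 0` (so the hypothesis set of the transfer is
satisfiable, e.g. `f = g = 1`, every `L`). -/
example : CorridorData 1 1 0 (fun _ => 1) where
  differentiableOn := differentiableOn_const _
  ne_zero := fun _ _ => one_ne_zero
  norm_le := fun _ _ => by simp
  real_on_axis := fun _ _ _ => by simp

end Probes

end Summit.Ventures.CertifiedManyBodySolver.Cruxes.ThermalStiffnessCeilingU8b10_le_1o8.ZerofreeCorridor
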